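import Literature.Analysis.FluidPDE.CylindricalGenerator
import Summits.AnomalousDissipation.AnomalousDissipation.Theorems.EnsembleRigidityResidualTransferSSSTestEnstrophyTame
import HarnessLib

/-!
# Tame closure (crux `TameRoughRigidity.TameClosure`, stmt-AnomalousDissipation-18402), line
`cutoff_compactness`: stub S2d `stub_cutoffAssembly`

The cut-off scheme on the tame class, ASSEMBLED from the registered tools S2a (product cut-off test
`Ψ`, `Ψ' = χ(|P_K v|²/ρ) Φ' + (2/ρ) χ' Φ P_K v`), S2b (generator bookkeeping, Cauchy–Schwarz,
Bernstein flux bound, continuity of `|P_K v|²`, Pythagoras) and S2c (projected stress, spectral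
tail), taken as hypotheses verbatim (Foias–Manley–Rosa–Temam 2001, Ch. IV App. B.1–B.2: Galerkin
cut-off tests `ψ(|P_m u|²)`). First clause: `|c L₀Φ − h| ≤ C_Φ |v| τ`, `τ² = |v|² − |P_K v|²`,
`2|v|τ ≤ α|v|² + τ²/α` and the integrated tail `∫ τ² dν ≤ G₁⁺/(4π²(K²+1))`; second clause:
`L₀Ψ = c L₀Φ + flux`, `|flux| ≤ (2/ρ)‖χ'‖‖φ‖√(2ρ)(‖f‖₂ + C_K|v|²)` (`χ' = 0` off `1 < t < 2`),
`|∫ L₀Ψ dν| ≤ δ √C_Ψ` (`ResidualTransferSSS.stub_testEnstrophyTame`). [FoiasManleyRosaTemam2001]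
-/

set_option linter.dupNamespace false

noncomputable section

namespace Summit.AnomalousDissipation.AnomalousDissipation.Theorems.TameRoughRigidity.TameClosure

open MeasureTheory Filter Topology UnitAddTorus
open scoped InnerProductSpace RealInnerProductSpace ENNReal NNReal
open Literature.Analysis.FunctionSpaces Literature.Analysis.FluidPDE

/-- Local notation: real vector fields on `T³`. -/
local notation "Vec3" => (UnitAddTorus (Fin 3)) → (EuclideanSpace ℝ (Fin 3))
/-- Local notation: `L²(T³; ℝ³)`. -/
local notation "L2" => (Lp (EuclideanSpace ℝ (Fin 3)) 2 (volume : Measure (UnitAddTorus (Fin 3))))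
/-- Local notation: the energy space `H`. -/
local notation "H3" => (Torus.energySpace (Fin 3))

/-- `χ' = 0` off the transition layer `1 < t < 2` (for `t ≥ 0`; `χ = Torus.galerkinCutoff`): `χ = 1` is
a maximum on `[-1, 1]` and `χ = 0` a minimum on `{2 ≤ |t|}`. [folklore] -/
theorem cutoffAssembly_deriv_cutoff_eq_zero {t : ℝ} (ht0 : 0 ≤ t) (ht : t ≤ 1 ∨ 2 ≤ t) :
    deriv (Torus.galerkinCutoff : ℝ → ℝ) t = 0 := by
  rcases ht with ht | ht
  · have h1 : (Torus.galerkinCutoff : ℝ → ℝ) t = 1 := Torus.galerkinCutoff.one_of_mem_closedBall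
      (by simpa [Torus.galerkinCutoff, abs_of_nonneg ht0] using ht)
    refine IsLocalMax.deriv_eq_zero ?_
    filter_upwards with s
    rw [h1]
    exact Torus.galerkinCutoff.le_one
  · have h1 : (Torus.galerkinCutoff : ℝ → ℝ) t = 0 := Torus.galerkinCutoff.zero_of_le_dist
      (by simpa [Torus.galerkinCutoff, Real.dist_eq, abs_of_nonneg ht0] using ht)
    refine IsLocalMin.deriv_eq_zero ?_
    filter_upwards with s
    rw [h1]
    exact Torus.galerkinCutoff.nonneg

/-- `χ'` is bounded: `|χ'(t)| ≤ C_χ` (continuous with compact support). [folklore] -/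
theorem cutoffAssembly_exists_abs_deriv_cutoff_le :
    ∃ C : ℝ, 0 ≤ C ∧ ∀ t, |deriv (Torus.galerkinCutoff : ℝ → ℝ) t| ≤ C := by
  obtain ⟨C, hC⟩ := ((Torus.galerkinCutoff.contDiff (n := 1)).continuous_deriv le_rfl)
    |>.bounded_above_of_compact_support Torus.galerkinCutoff.hasCompactSupport.deriv
  exact ⟨max C 0, le_max_right _ _, fun t => (Real.norm_eq_abs _ ▸ hC t).trans (le_max_left _ _)⟩

/-- The elementary inequality `C a b ≤ (C α / 2) a² + (C / (2 α)) b²` (`α > 0`, `C ≥ 0`). [folklore] -/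
theorem cutoffAssembly_amgm {C α : ℝ} (a b : ℝ) (hC : 0 ≤ C) (hα : 0 < α) :
    C * a * b ≤ C * α / 2 * a ^ 2 + C / (2 * α) * b ^ 2 := by
  have h2 : C * α / 2 * a ^ 2 + C / (2 * α) * b ^ 2 - C * a * b = C * (α * a - b) ^ 2 / (2 * α) := by
    field_simp
    ring
  linarith [show 0 ≤ C * (α * a - b) ^ 2 / (2 * α) by positivity]

set_option maxHeartbeats 400000 in
/-- **S2d `stub_cutoffAssembly`** — THE CUT-OFF SCHEME ON THE TAME CLASS from the tools S2a, S2b, S2c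
(hypotheses verbatim). Witnesses: `α` with `C_Φ E⁺ α ≤ ε/3`, `K` with `3 C_Φ G₁⁺ ≤ 4π² ε α (K²+1)`,
`ρ₀ = max 1 R²` with `R = 6√2 C_χ M_φ (‖f‖₂ + C_K E⁺)/ε`, `c = χ(|P_K v|²/ρ)`,
`h = c · Σᵢ ∂ᵢφ(coords v) [(f, gᵢ) + qᵢ(v)]`, `Ψ` from S2a, `δ` with `δ √C_Ψ ≤ ε/3`.
[cite: FoiasManleyRosaTemam2001, Ch. IV App. B.1–B.2] -/
theorem stub_cutoffAssembly
    (hA : ∀ (Φ : Torus.CylindricalTest (Fin 3)) (K : ℕ) (ρ : ℝ), 0 < ρ →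
      ∃ Ψ : Torus.CylindricalTest (Fin 3), ∀ v : H3, Ψ.grad v = fun x =>
        (Torus.galerkinCutoff : ℝ → ℝ) (Torus.truncNormSq K v / ρ) • Φ.grad v x +
          (2 / ρ * deriv (Torus.galerkinCutoff : ℝ → ℝ) (Torus.truncNormSq K v / ρ) * Φ.eval v) •
            Torus.fourierTruncate K (((v : L2)) : Vec3) x)
    (hB : (∀ (f : Vec3), Torus.IsSmooth f → ∀ (Φ : Torus.CylindricalTest (Fin 3)) (K : ℕ) (a b : ℝ) (v : H3),
        Torus.nsGeneratorPairing 0 f v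
            (fun x => a • Φ.grad v x + b • Torus.fourierTruncate K (((v : L2)) : Vec3) x) =
          a * Torus.nsGeneratorPairing 0 f v (Φ.grad v) +
            b * ((∫ x, ⟪f x, Torus.fourierTruncate K (((v : L2)) : Vec3) x⟫_ℝ) +
              Torus.inertialPairing (v : L2) (Torus.fourierTruncate K (((v : L2)) : Vec3)))) ∧
      (∀ (f : Vec3), MemLp f 2 volume → ∀ (K : ℕ) (v : H3),
        |∫ x, ⟪f x, Torus.fourierTruncate K (((v : L2)) : Vec3) x⟫_ℝ| ≤
          Real.sqrt (∫ x, ‖f x‖ ^ 2) * Real.sqrt (Torus.truncNormSq K v)) ∧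
      (∀ K : ℕ, ∃ C : ℝ, 0 ≤ C ∧ ∀ v : H3,
        |Torus.inertialPairing (v : L2) (Torus.fourierTruncate K (((v : L2)) : Vec3))| ≤
          C * Real.sqrt (Torus.truncNormSq K v) * ‖v‖ ^ 2) ∧
      (∀ K : ℕ, Continuous fun v : H3 => Torus.truncNormSq K v) ∧
      (∀ (K : ℕ) (v : H3),
        ∫ x, ‖(((v : L2)) : Vec3) x - Torus.fourierTruncate K (((v : L2)) : Vec3) x‖ ^ 2 =
          ‖v‖ ^ 2 - Torus.truncNormSq K v))
    (hC : (∀ (g : Vec3), Torus.IsSmooth g → ∃ C : ℝ, 0 ≤ C ∧ ∀ K : ℕ, ∃ (q : H3 → ℝ) (B : ℝ),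
        Continuous q ∧ (∀ v : H3, |q v| ≤ B * Torus.truncNormSq K v) ∧
        ∀ v : H3, |Torus.inertialPairing (v : L2) g - q v| ≤
          C * ‖v‖ * Real.sqrt (∫ x, ‖(((v : L2)) : Vec3) x - Torus.fourierTruncate K (((v : L2)) : Vec3) x‖ ^ 2)) ∧
      (∀ (K : ℕ) (v : H3),
        ENNReal.ofReal (4 * Real.pi ^ 2 * ((K : ℝ) ^ 2 + 1)) *
            ENNReal.ofReal (∫ x, ‖(((v : L2)) : Vec3) x - Torus.fourierTruncate K (((v : L2)) : Vec3) x‖ ^ 2) ≤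
          Torus.eGradNormSq (((v : L2)) : Vec3)))
    (f : Vec3) (hf : Torus.IsSmooth f) (Φ : Torus.CylindricalTest (Fin 3))
    (E G₁ ε : ℝ) (hε : 0 < ε) :
    ∃ ρ₀ : ℝ, ∀ ρ : ℝ, ρ₀ ≤ ρ →
      ∃ (c h : H3 → ℝ) (Ψ : Torus.CylindricalTest (Fin 3)) (δ : ℝ), 0 < δ ∧
        Continuous c ∧ Continuous h ∧ (∀ v, 0 ≤ c v ∧ c v ≤ 1) ∧ (∀ v : H3, ‖v‖ ^ 2 ≤ ρ → c v = 1) ∧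
        (∃ C : ℝ, ∀ v, |h v| ≤ C) ∧
        ∀ ν : Measure H3, IsProbabilityMeasure ν → Integrable (fun v : H3 => ‖v‖ ^ 2) ν →
          Torus.ensembleEnergy ν ≤ E → Torus.ensembleEnstrophy ν ≤ ENNReal.ofReal G₁ →
          |(∫ v, c v * Torus.nsGeneratorPairing 0 f v (Φ.grad v) ∂ν) - ∫ v, h v ∂ν| ≤ ε ∧
          (|∫ v, Torus.nsGeneratorPairing 0 f v (Ψ.grad v) ∂ν| ≤
              δ * Real.sqrt (∫ v, Torus.gradNormSq (Ψ.grad v) ∂ν) →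
            |∫ v, c v * Torus.nsGeneratorPairing 0 f v (Φ.grad v) ∂ν| ≤ ε) := by
  obtain ⟨hB1, hB2, hB3, hB4, hB5⟩ := hB
  obtain ⟨hC1, hC2⟩ := hC
  -- notation (opaque local names with pointwise defining equations; `set` is too slow here)
  obtain ⟨χ, hχ⟩ : ∃ χ : ℝ → ℝ, χ = (Torus.galerkinCutoff : ℝ → ℝ) := ⟨_, rfl⟩
  obtain ⟨L₀, hL₀v⟩ : ∃ L₀ : H3 → ℝ, ∀ v, L₀ v = Torus.nsGeneratorPairing 0 f v (Φ.grad v) := ⟨_, fun _ => rfl⟩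
  obtain ⟨dφ, hdφ⟩ : ∃ dφ : H3 → Fin Φ.m → ℝ, dφ = fun v i =>
    _root_.fderiv ℝ Φ.φ (Φ.coords v) (EuclideanSpace.single i 1) := ⟨_, rfl⟩
  have hf2 : MemLp f 2 volume := hf.memLp 2
  have hfi : Integrable f volume := hf2.integrable one_le_two
  obtain ⟨nf, hnf⟩ : ∃ nf : ℝ, nf = Real.sqrt (∫ x, ‖f x‖ ^ 2) := ⟨_, rfl⟩
  have hnf0 : 0 ≤ nf := hnf ▸ Real.sqrt_nonneg _
  -- constants of `Φ`, of `χ` and of the projected stresses (the latter independent of `K`)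
  obtain ⟨M, hM0, hM⟩ := Φ.exists_abs_fderiv_coords_le
  obtain ⟨Mφ, hMφ0, hMφb⟩ : ∃ Mφ : ℝ, 0 ≤ Mφ ∧ ∀ v : H3, |Φ.eval v| ≤ Mφ := by
    obtain ⟨Mφ', hMφ'⟩ := Φ.φ_contDiff.continuous.bounded_above_of_compact_support Φ.φ_compact
    exact ⟨max Mφ' 0, le_max_right _ _, fun v =>
      (Real.norm_eq_abs _ ▸ hMφ' (Φ.coords v)).trans (le_max_left _ _)⟩
  obtain ⟨Cχ, hCχ0, hCχ⟩ := cutoffAssembly_exists_abs_deriv_cutoff_le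
  obtain ⟨AΦ, -, hAΦ⟩ := Torus.exists_abs_nsGeneratorPairing_grad_le 0 hf2 Φ
  choose Cg hCg0 hCg using fun i : Fin Φ.m => hC1 (Φ.g i) (Φ.g_smooth i)
  obtain ⟨CΦ, hCΦ, hCΦ0⟩ : ∃ CΦ : ℝ, CΦ = ∑ i, M * Cg i ∧ 0 ≤ CΦ :=
    ⟨_, rfl, Finset.sum_nonneg fun i _ => mul_nonneg hM0 (hCg0 i)⟩
  obtain ⟨Ep, hEEp, hEp0⟩ : ∃ Ep : ℝ, E ≤ Ep ∧ 0 ≤ Ep := ⟨max E 0, le_max_left _ _, le_max_right _ _⟩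
  obtain ⟨Gp, hGGp, hGp0⟩ : ∃ Gp : ℝ, G₁ ≤ Gp ∧ 0 ≤ Gp := ⟨max G₁ 0, le_max_left _ _, le_max_right _ _⟩
  -- the budget `α`, the order `K`, the projected stresses at order `K`, the Bernstein constant
  obtain ⟨α, hα0, hα⟩ : ∃ α : ℝ, 0 < α ∧ CΦ * Ep * α ≤ ε / 3 := by
    refine ⟨ε / (3 * (CΦ * Ep + 1)), by positivity, ?_⟩
    rw [← mul_div_assoc, div_le_div_iff₀ (by positivity) (by norm_num)]
    nlinarith [mul_nonneg hCΦ0 hEp0, hε]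
  obtain ⟨K, hK2⟩ : ∃ K : ℕ, CΦ / (2 * α) * (Gp / (4 * Real.pi ^ 2 * ((K : ℝ) ^ 2 + 1))) ≤ ε / 6 := by
    obtain ⟨K, hK⟩ := exists_nat_ge (3 * CΦ * Gp / (4 * Real.pi ^ 2 * ε * α))
    have hK1 : 3 * CΦ * Gp / (4 * Real.pi ^ 2 * ε * α) ≤ (K : ℝ) ^ 2 + 1 :=
      hK.trans (by nlinarith [sq_nonneg ((K : ℝ) - 1), (Nat.cast_nonneg (α := ℝ) K)])
    refine ⟨K, ?_⟩
    rw [div_le_iff₀ (by positivity)] at hK1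
    rw [div_mul_div_comm, div_le_div_iff₀ (by positivity) (by norm_num)]
    nlinarith [hK1, Real.pi_pos]
  choose q B hqc hqB hqe using fun i : Fin Φ.m => hCg i K
  obtain ⟨CK, hCK0, hCK⟩ := hB3 K
  -- the level `ρ₀`
  obtain ⟨ρ₀, hρ₀1, hρ₀⟩ : ∃ ρ₀ : ℝ, 1 ≤ ρ₀ ∧ ∀ ρ : ℝ, ρ₀ ≤ ρ →
      2 * Real.sqrt 2 * Cχ * Mφ * (nf + CK * Ep) / Real.sqrt ρ ≤ ε / 3 := by
    obtain ⟨X, hX⟩ : ∃ X : ℝ, X = Cχ * Mφ * (nf + CK * Ep) := ⟨_, rfl⟩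
    have hX0 : 0 ≤ X := by rw [hX]; positivity
    refine ⟨max 1 ((6 * Real.sqrt 2 * X / ε) ^ 2), le_max_left _ _, fun ρ hρ => ?_⟩
    have hsρ : 0 < Real.sqrt ρ := Real.sqrt_pos.2 (one_pos.trans_le ((le_max_left _ _).trans hρ))
    have hRρ : 6 * Real.sqrt 2 * X / ε ≤ Real.sqrt ρ := by
      rw [← Real.sqrt_sq (by positivity : (0 : ℝ) ≤ 6 * Real.sqrt 2 * X / ε)]
      exact Real.sqrt_le_sqrt ((le_max_right _ _).trans hρ)
    rw [div_le_iff₀ hε] at hRρ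
    rw [div_le_div_iff₀ hsρ (by norm_num),
      show 2 * Real.sqrt 2 * Cχ * Mφ * (nf + CK * Ep) = 2 * Real.sqrt 2 * X by rw [hX]; ring]
    nlinarith [hRρ, Real.sqrt_nonneg 2]
  refine ⟨ρ₀, fun ρ hρ => ?_⟩
  have hρ0 : 0 < ρ := one_pos.trans_le (hρ₀1.trans hρ)
  have hsρ : 0 < Real.sqrt ρ := Real.sqrt_pos.2 hρ0
  -- the cut-off test, its enstrophy bound, its generator growth
  obtain ⟨Ψ, hΨ⟩ := hA Φ K ρ hρ0
  obtain ⟨hΨc, CΨ, hCΨ0, hCΨ'⟩ : Continuous (fun u : H3 => Torus.gradNormSq (Ψ.grad u)) ∧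
      ∃ C : ℝ, 0 ≤ C ∧ ∀ u : H3, Torus.gradNormSq (Ψ.grad u) ≤ C := by
    obtain ⟨hc, C, hC⟩ := ResidualTransferSSS.stub_testEnstrophyTame Ψ
    exact ⟨hc, max C 0, le_max_right _ _, fun u => (hC u).trans (le_max_left _ _)⟩
  obtain ⟨AΨ, -, hAΨ⟩ := Torus.exists_abs_nsGeneratorPairing_grad_le 0 hf2 Ψ
  -- the witnesses `c`, `h`, `δ`
  obtain ⟨t, htv⟩ : ∃ t : H3 → ℝ, ∀ v, t v = Torus.truncNormSq K v / ρ := ⟨_, fun _ => rfl⟩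
  obtain ⟨c, hcv⟩ : ∃ c : H3 → ℝ, ∀ v, c v = χ (t v) := ⟨_, fun _ => rfl⟩
  obtain ⟨hh, hhv⟩ : ∃ hh : H3 → ℝ,
      ∀ v, hh v = c v * ∑ i, dφ v i * ((∫ x, ⟪f x, Φ.g i x⟫_ℝ) + q i v) := ⟨_, fun _ => rfl⟩
  obtain ⟨δ, hδ0, hδ⟩ : ∃ δ : ℝ, 0 < δ ∧ δ * Real.sqrt CΨ ≤ ε / 3 := by
    refine ⟨ε / (3 * (Real.sqrt CΨ + 1)), by positivity, ?_⟩
    rw [div_mul_eq_mul_div, div_le_div_iff₀ (by positivity) (by norm_num)]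
    nlinarith [Real.sqrt_nonneg CΨ, hε]
  have ht0 : ∀ v, 0 ≤ t v := fun v => (htv v).symm ▸ div_nonneg (Torus.truncNormSq_nonneg K v) hρ0.le
  have hcc : Continuous c := by
    rw [show c = fun v => χ (Torus.truncNormSq K v / ρ) from funext fun v => by rw [hcv, htv], hχ]
    exact Torus.galerkinCutoff.continuous.comp ((hB4 K).div_const ρ)
  have hc01 : ∀ v, 0 ≤ c v ∧ c v ≤ 1 := fun v => by
    rw [hcv, hχ]
    exact ⟨Torus.galerkinCutoff.nonneg, Torus.galerkinCutoff.le_one⟩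
  have hc1 : ∀ v : H3, ‖v‖ ^ 2 ≤ ρ → c v = 1 := by
    intro v hv
    rw [hcv, hχ]
    refine Torus.galerkinCutoff.one_of_mem_closedBall ?_
    rw [Metric.mem_closedBall, Real.dist_eq, sub_zero, abs_of_nonneg (ht0 v), htv]
    show Torus.truncNormSq K v / ρ ≤ 1
    exact (div_le_one hρ0).2 ((Torus.truncNormSq_le K v).trans hv)
  -- off `t < 2` the cut-off vanishes; on it `|P_K v|² < 2ρ`
  have hc2 : ∀ v : H3, 2 ≤ t v → c v = 0 := fun v hv => by
    rw [hcv, hχ]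
    exact Torus.galerkinCutoff.zero_of_le_dist (by
      rw [Real.dist_eq, sub_zero, abs_of_nonneg (ht0 v)]; exact hv)
  have htrunc : ∀ v : H3, t v < 2 → Torus.truncNormSq K v < 2 * ρ := fun v hv => by
    rwa [htv, div_lt_iff₀ hρ0] at hv
  have hhc : Continuous hh := by
    rw [show hh = _ from funext hhv, hdφ]
    exact hcc.mul (continuous_finsetSum _ fun i _ =>
      (Φ.continuous_fderiv_coords i).mul (continuous_const.add (hqc i)))
  have hMd : ∀ (v : H3) (i : Fin Φ.m), |dφ v i| ≤ M := fun v i => by rw [hdφ]; exact hM v i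
  have hhb : ∃ C : ℝ, ∀ v, |hh v| ≤ C := by
    refine ⟨∑ i, M * (|∫ x, ⟪f x, Φ.g i x⟫_ℝ| + |B i| * (2 * ρ)), fun v => ?_⟩
    by_cases hv : 2 ≤ t v
    · rw [hhv, hc2 v hv, zero_mul, abs_zero]
      exact Finset.sum_nonneg fun i _ => by positivity
    · rw [hhv, abs_mul, abs_of_nonneg (hc01 v).1]
      refine (mul_le_of_le_one_left (abs_nonneg _) (hc01 v).2).trans
        ((Finset.abs_sum_le_sum_abs _ _).trans (Finset.sum_le_sum fun i _ => ?_))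
      rw [abs_mul]
      refine mul_le_mul (hMd v i) ((abs_add_le _ _).trans (add_le_add le_rfl ?_)) (abs_nonneg _) hM0
      refine (hqB i v).trans ((mul_le_mul_of_nonneg_right (le_abs_self _)
        (Torus.truncNormSq_nonneg K v)).trans ?_)
      exact mul_le_mul_of_nonneg_left (htrunc v (not_le.1 hv)).le (abs_nonneg _)
  refine ⟨c, hh, Ψ, δ, hδ0, hcc, hhc, hc01, hc1, hhb, fun ν hν hint hE hG => ?_⟩
  -- the tame measure `ν`: integrated energy and tail bounds
  have hEν : ∫ v, ‖v‖ ^ 2 ∂ν ≤ Ep := hE.trans hEEp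
  obtain ⟨τ2, hτ2v⟩ : ∃ τ2 : H3 → ℝ, ∀ v, τ2 v = ‖v‖ ^ 2 - Torus.truncNormSq K v := ⟨_, fun _ => rfl⟩
  have hτ20 : ∀ v, 0 ≤ τ2 v := fun v => (hτ2v v).symm ▸ sub_nonneg.2 (Torus.truncNormSq_le K v)
  have hτ2c : Continuous τ2 := (funext hτ2v : τ2 = _) ▸ (continuous_norm.pow 2).sub (hB4 K)
  have hτ2i : Integrable τ2 ν := by
    refine Integrable.mono' hint hτ2c.aestronglyMeasurable (ae_of_all _ fun v => ?_)
    rw [Real.norm_eq_abs, abs_of_nonneg (hτ20 v), hτ2v]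
    exact sub_le_self _ (Torus.truncNormSq_nonneg K v)
  have htail : ∫ v, τ2 v ∂ν ≤ Gp / (4 * Real.pi ^ 2 * ((K : ℝ) ^ 2 + 1)) := by
    have hden : (0 : ℝ) < 4 * Real.pi ^ 2 * ((K : ℝ) ^ 2 + 1) := by positivity
    have hpt : ∀ v : H3, ENNReal.ofReal (τ2 v) ≤
        Torus.eGradNormSq (((v : L2)) : Vec3) / ENNReal.ofReal (4 * Real.pi ^ 2 * ((K : ℝ) ^ 2 + 1)) := by
      intro v
      rw [ENNReal.le_div_iff_mul_le (Or.inl ((ENNReal.ofReal_pos.2 hden).ne'))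
        (Or.inl ENNReal.ofReal_ne_top), mul_comm, hτ2v, ← hB5 K v]
      exact hC2 K v
    have h1 : ∫⁻ v, ENNReal.ofReal (τ2 v) ∂ν ≤
        ENNReal.ofReal Gp / ENNReal.ofReal (4 * Real.pi ^ 2 * ((K : ℝ) ^ 2 + 1)) := by
      refine (lintegral_mono hpt).trans ?_
      simp_rw [div_eq_mul_inv]
      rw [lintegral_mul_const _ Torus.measurable_eGradNormSq_coe]
      gcongr
      exact hG.trans (ENNReal.ofReal_le_ofReal hGGp)
    rw [integral_eq_lintegral_of_nonneg_ae (ae_of_all _ hτ20) hτ2c.aestronglyMeasurable]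
    have h2 := ENNReal.toReal_mono (ENNReal.div_ne_top ENNReal.ofReal_ne_top
      ((ENNReal.ofReal_pos.2 hden).ne')) h1
    rwa [ENNReal.toReal_div, ENNReal.toReal_ofReal hGp0, ENNReal.toReal_ofReal hden.le] at h2
  -- integrability of the cut tested generator and of `h`
  have hquad : Integrable (fun v : H3 => (1 : ℝ) + ‖v‖ ^ 2) ν := (integrable_const _).add hint
  have hcL₀i : Integrable (fun v => c v * L₀ v) ν := by
    refine Integrable.mono' (hquad.const_mul AΦ) (hcc.mul ?_).aestronglyMeasurable
      (ae_of_all _ fun v => ?_)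
    · rw [show L₀ = _ from funext hL₀v]
      exact Torus.continuous_nsGeneratorPairing_grad 0 hfi Φ
    rw [Real.norm_eq_abs, abs_mul, abs_of_nonneg (hc01 v).1, hL₀v]
    exact (mul_le_of_le_one_left (abs_nonneg _) (hc01 v).2).trans (hAΦ v)
  obtain ⟨Ch, hCh⟩ := hhb
  have hhi : Integrable hh ν := Integrable.mono' (integrable_const Ch) hhc.aestronglyMeasurable
    (ae_of_all _ fun v => (Real.norm_eq_abs _).symm ▸ hCh v)
  rw [show (fun v => c v * Torus.nsGeneratorPairing 0 f v (Φ.grad v)) = fun v => c v * L₀ v from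
    funext fun v => by rw [hL₀v]]
  refine ⟨?_, fun hdef => ?_⟩
  · -- FIRST CLAUSE: `|∫ c L₀Φ − ∫ h| ≤ ε`
    have hpt : ∀ v, c v * L₀ v - hh v =
        c v * ∑ i, dφ v i * (Torus.inertialPairing (v : L2) (Φ.g i) - q i v) := by
      intro v
      rw [hhv, hL₀v, Torus.nsGeneratorPairing_grad 0 hfi Φ v, hdφ, ← mul_sub,
        ← Finset.sum_sub_distrib]
      refine congrArg _ (Finset.sum_congr rfl fun i _ => ?_)
      rw [Torus.nsGeneratorPairing]
      ring
    have hbd : ∀ v, |c v * L₀ v - hh v| ≤ CΦ * α / 2 * ‖v‖ ^ 2 + CΦ / (2 * α) * τ2 v := by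
      intro v
      have hτ : Real.sqrt (∫ x, ‖(((v : L2)) : Vec3) x -
          Torus.fourierTruncate K (((v : L2)) : Vec3) x‖ ^ 2) = Real.sqrt (τ2 v) := by
        rw [hB5 K v, hτ2v]
      have h1 : |c v * L₀ v - hh v| ≤ CΦ * ‖v‖ * Real.sqrt (τ2 v) := by
        rw [hpt, abs_mul, abs_of_nonneg (hc01 v).1, hCΦ, Finset.sum_mul, Finset.sum_mul]
        refine (mul_le_of_le_one_left (abs_nonneg _) (hc01 v).2).trans
          ((Finset.abs_sum_le_sum_abs _ _).trans (Finset.sum_le_sum fun i _ => ?_))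
        rw [abs_mul]
        calc |dφ v i| * |Torus.inertialPairing (v : L2) (Φ.g i) - q i v|
            ≤ M * (Cg i * ‖v‖ * Real.sqrt (τ2 v)) :=
              mul_le_mul (hMd v i) ((hqe i v).trans (le_of_eq (by rw [hτ]))) (abs_nonneg _) hM0
          _ = M * Cg i * ‖v‖ * Real.sqrt (τ2 v) := by ring
      have h2 := cutoffAssembly_amgm ‖v‖ (Real.sqrt (τ2 v)) hCΦ0 hα0
      rw [Real.sq_sqrt (hτ20 v)] at h2
      exact h1.trans h2
    rw [← integral_sub hcL₀i hhi]
    calc |∫ v, c v * L₀ v - hh v ∂ν| ≤ ∫ v, |c v * L₀ v - hh v| ∂ν := by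
          rw [← Real.norm_eq_abs]; exact norm_integral_le_integral_norm _
      _ ≤ ∫ v, CΦ * α / 2 * ‖v‖ ^ 2 + CΦ / (2 * α) * τ2 v ∂ν :=
          integral_mono (hcL₀i.sub hhi).abs ((hint.const_mul _).add (hτ2i.const_mul _)) hbd
      _ = CΦ * α / 2 * ∫ v, ‖v‖ ^ 2 ∂ν + CΦ / (2 * α) * ∫ v, τ2 v ∂ν := by
          rw [integral_add (hint.const_mul _) (hτ2i.const_mul _), integral_const_mul,
            integral_const_mul]
      _ ≤ CΦ * α / 2 * Ep + CΦ / (2 * α) * (Gp / (4 * Real.pi ^ 2 * ((K : ℝ) ^ 2 + 1))) := by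
          gcongr
      _ ≤ ε / 6 + ε / 6 := add_le_add (by nlinarith [hα, mul_nonneg hCΦ0 hEp0]) hK2
      _ ≤ ε := by linarith
  · -- SECOND CLAUSE: the defect bound at `Ψ` gives `|∫ c L₀Φ| ≤ ε`
    obtain ⟨κ, hκv⟩ : ∃ κ : H3 → ℝ, ∀ v, κ v = 2 / ρ * deriv χ (t v) * Φ.eval v := ⟨_, fun _ => rfl⟩
    obtain ⟨Pv, hPvv⟩ : ∃ Pv : H3 → Vec3, ∀ v, Pv v = Torus.fourierTruncate K (((v : L2)) : Vec3) := ⟨_, fun _ => rfl⟩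
    obtain ⟨flux, hfluxv⟩ : ∃ flux : H3 → ℝ, ∀ v, flux v =
        κ v * ((∫ x, ⟪f x, Pv v x⟫_ℝ) + Torus.inertialPairing (v : L2) (Pv v)) := ⟨_, fun _ => rfl⟩
    have hid : ∀ v, Torus.nsGeneratorPairing 0 f v (Ψ.grad v) = c v * L₀ v + flux v := by
      intro v
      rw [hΨ v, hfluxv, hPvv, hκv, hcv, hL₀v, htv, hχ]
      exact hB1 f hf Φ K _ _ v
    -- pointwise flux bound, with the constant `A₀ = (2/ρ) C_χ M_φ √(2ρ)`
    obtain ⟨A₀, hA₀⟩ : ∃ A₀ : ℝ, A₀ = 2 / ρ * Cχ * Mφ * Real.sqrt (2 * ρ) := ⟨_, rfl⟩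
    have hA₀0 : 0 ≤ A₀ := by rw [hA₀]; positivity
    have hfb : ∀ v, |flux v| ≤ A₀ * nf + A₀ * CK * ‖v‖ ^ 2 := fun v => by
      by_cases hlay : t v ≤ 1 ∨ 2 ≤ t v
      · rw [hfluxv, hκv, hχ, cutoffAssembly_deriv_cutoff_eq_zero (ht0 v) hlay, mul_zero,
          zero_mul, zero_mul, abs_zero]
        positivity
      · push Not at hlay
        have hs : Real.sqrt (Torus.truncNormSq K v) ≤ Real.sqrt (2 * ρ) :=
          Real.sqrt_le_sqrt (htrunc v hlay.2).le
        have hκb : |κ v| ≤ 2 / ρ * Cχ * Mφ := by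
          rw [hκv, hχ, abs_mul, abs_mul, abs_of_pos (by positivity : (0 : ℝ) < 2 / ρ)]
          exact mul_le_mul (mul_le_mul_of_nonneg_left (hCχ _) (by positivity)) (hMφb v)
            (abs_nonneg _) (by positivity)
        have h1 : |∫ x, ⟪f x, Pv v x⟫_ℝ| ≤ nf * Real.sqrt (2 * ρ) := by
          rw [hPvv, hnf]
          exact (hB2 f hf2 K v).trans (mul_le_mul_of_nonneg_left hs (Real.sqrt_nonneg _))
        have h2 : |Torus.inertialPairing (v : L2) (Pv v)| ≤ CK * Real.sqrt (2 * ρ) * ‖v‖ ^ 2 := by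
          rw [hPvv]
          exact (hCK v).trans (mul_le_mul_of_nonneg_right (mul_le_mul_of_nonneg_left hs hCK0)
            (sq_nonneg _))
        rw [hfluxv, abs_mul]
        calc |κ v| * |(∫ x, ⟪f x, Pv v x⟫_ℝ) + Torus.inertialPairing (v : L2) (Pv v)|
            ≤ (2 / ρ * Cχ * Mφ) * (nf * Real.sqrt (2 * ρ) + CK * Real.sqrt (2 * ρ) * ‖v‖ ^ 2) :=
              mul_le_mul hκb ((abs_add_le _ _).trans (add_le_add h1 h2)) (abs_nonneg _)
                (by positivity)
          _ = A₀ * nf + A₀ * CK * ‖v‖ ^ 2 := by rw [hA₀]; ring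
    -- integrability of `L₀Ψ` and of the flux
    have hΨi : Integrable (fun v => Torus.nsGeneratorPairing 0 f v (Ψ.grad v)) ν :=
      Integrable.mono' (hquad.const_mul AΨ)
        (Torus.continuous_nsGeneratorPairing_grad 0 hfi Ψ).aestronglyMeasurable
        (ae_of_all _ fun v => (Real.norm_eq_abs _).symm ▸ hAΨ v)
    have hfluxi : Integrable flux ν := by
      rw [show flux = fun v => Torus.nsGeneratorPairing 0 f v (Ψ.grad v) - c v * L₀ v from
        funext fun v => by rw [hid v]; ring]
      exact hΨi.sub hcL₀i
    have hgeom : A₀ * (nf + CK * Ep) = 2 * Real.sqrt 2 * Cχ * Mφ * (nf + CK * Ep) / Real.sqrt ρ := by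
      have hsρ2 : Real.sqrt ρ ^ 2 = ρ := Real.sq_sqrt hρ0.le
      rw [hA₀, Real.sqrt_mul zero_le_two, eq_div_iff hsρ.ne']
      calc 2 / ρ * Cχ * Mφ * (Real.sqrt 2 * Real.sqrt ρ) * (nf + CK * Ep) * Real.sqrt ρ
          = 2 / ρ * Real.sqrt 2 * Cχ * Mφ * (nf + CK * Ep) * Real.sqrt ρ ^ 2 := by ring
        _ = 2 * Real.sqrt 2 * Cχ * Mφ * (nf + CK * Ep) := by rw [hsρ2]; field_simp
    have hfluxI : |∫ v, flux v ∂ν| ≤ ε / 3 := by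
      have hb : Integrable (fun v : H3 => A₀ * nf + A₀ * CK * ‖v‖ ^ 2) ν :=
        (integrable_const _).add (hint.const_mul _)
      calc |∫ v, flux v ∂ν| ≤ ∫ v, |flux v| ∂ν := by
            rw [← Real.norm_eq_abs]; exact norm_integral_le_integral_norm _
        _ ≤ ∫ v, A₀ * nf + A₀ * CK * ‖v‖ ^ 2 ∂ν := integral_mono hfluxi.abs hb hfb
        _ = A₀ * nf + A₀ * CK * ∫ v, ‖v‖ ^ 2 ∂ν := by
            rw [integral_add (integrable_const _) (hint.const_mul _), integral_const,
              integral_const_mul, smul_eq_mul, probReal_univ, one_mul]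
        _ ≤ A₀ * nf + A₀ * CK * Ep := by gcongr
        _ = 2 * Real.sqrt 2 * Cχ * Mφ * (nf + CK * Ep) / Real.sqrt ρ := by rw [← hgeom]; ring
        _ ≤ ε / 3 := hρ₀ ρ hρ
    -- the defect at `Ψ`
    have hΨI : |∫ v, Torus.nsGeneratorPairing 0 f v (Ψ.grad v) ∂ν| ≤ ε / 3 := by
      have hgi : Integrable (fun v : H3 => Torus.gradNormSq (Ψ.grad v)) ν :=
        Integrable.mono' (integrable_const CΨ) hΨc.aestronglyMeasurable (ae_of_all _ fun v => by
          rw [Real.norm_eq_abs, abs_of_nonneg (Torus.gradNormSq_nonneg _)]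
          exact hCΨ' v)
      have hens : ∫ v, Torus.gradNormSq (Ψ.grad v) ∂ν ≤ CΨ :=
        (integral_mono hgi (integrable_const _) fun v => hCΨ' v).trans
          (by rw [integral_const, smul_eq_mul, probReal_univ, one_mul])
      exact hdef.trans ((mul_le_mul_of_nonneg_left (Real.sqrt_le_sqrt hens) hδ0.le).trans hδ)
    -- conclude
    have heq : ∫ v, c v * L₀ v ∂ν =
        (∫ v, Torus.nsGeneratorPairing 0 f v (Ψ.grad v) ∂ν) - ∫ v, flux v ∂ν := by
      rw [← integral_sub hΨi hfluxi]
      refine integral_congr_ae (ae_of_all _ fun v => ?_)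
      show c v * L₀ v = Torus.nsGeneratorPairing 0 f v (Ψ.grad v) - flux v
      rw [hid v]
      ring
    rw [heq]
    exact (abs_sub _ _).trans ((add_le_add hΨI hfluxI).trans (by linarith))

end Summit.AnomalousDissipation.AnomalousDissipation.Theorems.TameRoughRigidity.TameClosure

end
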